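import Literature.AlgebraicGeometry.Resolution.MultisectionHyperplaneCharts
import Literature.AlgebraicGeometry.Resolution.GenericFormChartConditions
import Literature.AlgebraicGeometry.Resolution.GenericFormTransversal
import Literature.AlgebraicGeometry.Resolution.SubschemeFibreReduced
import Literature.AlgebraicGeometry.Resolution.HypersurfaceSectionFibreDim
import Literature.AlgebraicGeometry.Resolution.FibreDimensionOne
import HarnessLib

/-!
# De Jong's multisection lemma: the generic hypersurface section through three generic forms (Lemma 4.13, (A1)–(A4))

Topic: `Literature/AlgebraicGeometry/Resolution`. Pure proofs (no definition, no named fact) of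
the construction in de Jong's proof of Lemma 4.13 (de Jong 1996, pp. 69–70): for a projective
curve fibration `f : X → Y` over an algebraically closed field and a closed point `y ∈ Y`, a
suitably general hypersurface section `H ⊂ X` is an effective Cartier divisor, finite over `Y`
("`H ∉ pr₁(T)`", "`f|_H` is quasi-finite hence finite"), meets `f⁻¹(y)` inside `sm(X/Y)` and
in a reduced scheme. Here "hyperplane for the embedding by `𝒪(n)`, `n ≥ 3`" is replaced by the
product `G₁G₂G₃` of THREE generic forms of degree `m` (so that the count "`≥ 3` points on every
component of every geometric fibre", de Jong's "`deg G ≥ n ≥ 3`", needs no degree theory —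
`AlterationsMultisectionHyperplaneHolds.lean`); the generic conditions are those of
`GenericFormChartConditions.lean` ((c1) avoid the finitely many non-smooth points of `f⁻¹(y)`,
(c2) contain no component of any closed fibre — on finitely many charts, `pr₁(T) ≠ 𝐏^∨`) and
`GenericFormTransversal.lean` ((c3) simple zeros on the smooth curve `f⁻¹(y)`), plus (c4) the
three forms have pairwise disjoint zeros on `f⁻¹(y)` (each avoids the finitely many zeros of the
previous ones).

* **`exists_generic_hypersurface_section`** — the existence of `m ≥ 1`, `G₁, G₂, G₃` of degree
  `m` and `I = V(G₁G₂G₃(s))` with: (A1) `I` effective Cartier; (A2) `dim (V(I) ∩ f⁻¹(y')) ≤ 0`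
  for every `y' ∈ Y`; (A3) `V(I) ∩ f⁻¹(y) ⊆ sm(f)`; (A4) the scheme-theoretic fibre of
  `V(I) → Y` over `y` reduced; and `V(I) → Y` finite.

## References

* A. J. de Jong, *Smoothness, semi-stability and alterations*, Publ. Math. IHÉS 83 (1996),
  Lemma 4.13 (proof), pp. 69–70. [DeJong1996]
-/

noncomputable section

universe u

open CategoryTheory AlgebraicGeometry Limits TopologicalSpace Opposite Topology IsLocalRing
open Literature.AlgebraicGeometry.Motives Literature.AlgebraicGeometry.Motives.Segre
  Literature.AlgebraicGeometry.Motives.GeneratingSections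

attribute [local instance] MvPolynomial.gradedAlgebra

namespace Literature.AlgebraicGeometry.Resolution

variable {k : Type u} [Field k] {Z : SchemeOver k} {n : ℕ} (ι : Z ⟶ projectiveSpace n k)
  [IsClosedImmersion ι.left]

attribute [local instance] FieldNorm.secAlgebra

/-! ### Preliminaries -/

omit [IsClosedImmersion ι.left] in
/-- `Γ(X, V)` is a finitely generated `k`-algebra for an affine open `V` of a `k`-scheme `X`
locally of finite type (Mathlib `HasRingHomProperty.appLE`). [folklore] -/
private theorem finiteType_sec'' [LocallyOfFiniteType Z.hom] {V : Z.left.Opens}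
    (hV : IsAffineOpen V) : Algebra.FiniteType k Γ(Z.left, V) := by
  have h1 : (Z.hom.appLE ⊤ V le_top).hom.FiniteType :=
    HasRingHomProperty.appLE @LocallyOfFiniteType Z.hom inferInstance
      ⟨⊤, isAffineOpen_top _⟩ ⟨V, hV⟩ le_top
  have h2 : (Scheme.ΓSpecIso (.of k)).inv.hom.FiniteType :=
    RingHom.FiniteType.of_surjective _
      (Scheme.ΓSpecIso (.of k)).commRingCatIsoToRingEquiv.symm.surjective
  have h3 := RingHom.FiniteType.comp h1 h2
  rw [← CommRingCat.hom_comp] at h3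
  exact h3

omit [IsClosedImmersion ι.left] in
/-- The chart value of a product of forms is the product of the chart values, after
restriction. [folklore] -/
private theorem rs_sectionsFun_mul {i : Fin (n + 1)} {W : Z.left.Opens} (hW : W ≤ preU (emb ι) i)
    (F₁ F₂ : MvPolynomial (Fin (n + 1)) k) :
    Z.left.presheaf.map (homOfLE hW).op ((ofHom (emb ι)).sectionsFun Z.hom i (F₁ * F₂)) =
      Z.left.presheaf.map (homOfLE hW).op ((ofHom (emb ι)).sectionsFun Z.hom i F₁) *
        Z.left.presheaf.map (homOfLE hW).op ((ofHom (emb ι)).sectionsFun Z.hom i F₂) := by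
  rw [map_mul]
  exact map_mul _ _ _

variable {Y : Scheme.{u}} (f : Z.left ⟶ Y)

/-- **(A2) at a closed point from the chart conditions (c2).** If finitely many basic open charts
`W_a = (r⁻¹D₊(x_{i_a}))_{h_a} ⊆ f⁻¹(U_a)` cover `X` and the chart value of the form `F` on each
`W_a` lies in no minimal prime of `𝔫Γ(W_a)` for every maximal `𝔫 ⊆ Γ(Y, U_a)`, then
`X ∩ V₊(F) ∩ f⁻¹(y')` has dimension `≤ 0` for every closed point `y'`
(`topologicalKrullDim_support_inter_preimage_le_zero`). [cite: DeJong1996, Lemma 4.13 (proof), pp. 69–70] -/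
theorem topologicalKrullDim_le_zero_of_charts [QuasiSeparatedSpace Z.left]
    (hdim : ∀ (y : Y), ∀ C ∈ irreducibleComponents ↥(f.fiber y), topologicalKrullDim ↥C = 1)
    (t : Finset (Σ (U : Y.affineOpens) (i : Fin (n + 1)),
      {h : Γ(Z.left, preU (emb ι) i) // Z.left.basicOpen h ≤ f ⁻¹ᵁ (U : Y.Opens)}))
    (ht : ∀ x : Z.left, ∃ a ∈ t, x ∈ Z.left.basicOpen a.2.2.1)
    {d : ℕ} (F : MvPolynomial (Fin (n + 1)) k) (hF : F.IsHomogeneous d)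
    (hc2 : ∀ a ∈ t, ∀ 𝔫 : Ideal Γ(Y, (a.1 : Y.Opens)), 𝔫.IsMaximal →
      ∀ P ∈ (𝔫.map (f.appLE a.1 (Z.left.basicOpen a.2.2.1) a.2.2.2).hom).minimalPrimes,
        Z.left.presheaf.map (homOfLE (Z.left.basicOpen_le a.2.2.1)).op
          ((ofHom (emb ι)).sectionsFun Z.hom a.2.1 F) ∉ P)
    {y' : Y} (hy' : IsClosed ({y'} : Set Y)) :
    topologicalKrullDim
      ↥((((ofHom (emb ι)).secOfForm Z.hom F hF).zeroIdeal.support : Set Z.left) ∩ f ⁻¹' {y'}) ≤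
        0 := by
  refine topologicalKrullDim_support_inter_preimage_le_zero ι f F hF hy'
    (fun C hC => (hdim y' C hC).le) fun z hz => ?_
  obtain ⟨a, ha, hza⟩ := ht z
  have hyU : y' ∈ (a.1 : Y.Opens) := by
    have := a.2.2.2 hza
    rwa [← hz]
  refine ⟨a.1, a.1.2, hyU, a.2.1, a.2.2.1, a.2.2.2, hza, fun P hP => ?_⟩
  haveI : (a.1.2.primeIdealOf ⟨y', hyU⟩).asIdeal.IsMaximal :=
    a.1.2.primeIdealOf_isMaximal_of_isClosed ⟨y', hyU⟩ hy'
  exact hc2 a ha _ this P hP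

/-! ### The construction -/

variable [IsAlgClosed k] (g : Y ⟶ Spec (.of k))

/-- **De Jong's generic hypersurface section (proof of Lemma 4.13, (A1)–(A4)).** Let `k` be
algebraically closed, `X ↪ ℙⁿ_k` a closed subscheme (with its structure of `k`-scheme
`Z = (X → Spec k)`) which is integral, `Y` an integral `k`-scheme projective over `k`,
`f : X → Y` a surjective `k`-morphism locally of finite presentation whose fibres have all their
irreducible components of dimension `1` and a dense smooth locus, and `y ∈ Y` a closed point.
Then there are `m ≥ 1`, forms `G₁, G₂, G₃` of degree `m`, and the ideal sheaf `I` of the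
hypersurface section `H = X ∩ V₊(G₁G₂G₃)` such that: (A1) `I` is an effective Cartier divisor;
(A2) `H ∩ f⁻¹(y')` has dimension `≤ 0` for every `y' ∈ Y` ("`H ∉ pr₁(T)`"; "`f|_H` is
quasi-finite hence finite"); (A3) `H ∩ f⁻¹(y) ⊂ sm(X/Y)`; (A4) the scheme-theoretic fibre
`H ∩ f⁻¹(y)` is reduced; and `f|_H` is finite. The forms are chosen generically: avoiding the
finitely many non-smooth points of `f⁻¹(y)`, containing no component of any closed fibre on
finitely many charts covering `X` (`GenericFormChartConditions`), cutting the smooth curve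
`f⁻¹(y) ∩ sm(f)` transversally (`GenericFormTransversal`), and with pairwise disjoint zero sets
on `f⁻¹(y)`. [cite: DeJong1996, Lemma 4.13 (proof), pp. 69–70] -/
theorem exists_generic_hypersurface_section [IsIntegral Z.left] [IsIntegral Y]
    [LocallyOfFinitePresentation f] (hf : f ≫ g = Z.hom) (hY : IsProjectiveOver (Over.mk g))
    (hsurj : Surjective f)
    (hdim : ∀ (y : Y), ∀ C ∈ irreducibleComponents ↥(f.fiber y), topologicalKrullDim ↥C = 1)
    (hdense : ∀ y : Y, Dense ((f.fiberι y) ⁻¹' (f.smoothLocus : Set Z.left)))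
    (y : Y) (hy : IsClosed ({y} : Set Y)) :
    ∃ (m : ℕ) (_ : 0 < m) (G₁ G₂ G₃ : MvPolynomial (Fin (n + 1)) k) (h₁ : G₁.IsHomogeneous m)
      (h₂ : G₂.IsHomogeneous m) (h₃ : G₃.IsHomogeneous m) (I : Z.left.IdealSheafData),
      I = ((ofHom (emb ι)).secOfForm Z.hom (G₁ * G₂ * G₃) ((h₁.mul h₂).mul h₃)).zeroIdeal ∧
      IsEffectiveCartier I ∧
      (∀ y' : Y, topologicalKrullDim ↥((I.support : Set Z.left) ∩ f ⁻¹' {y'}) ≤ 0) ∧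
      (I.support : Set Z.left) ∩ f ⁻¹' {y} ⊆ f.smoothLocus ∧
      IsReduced ((I.subschemeι ≫ f).fiber y) ∧
      IsFinite (I.subschemeι ≫ f) := by
  classical
  haveI : IsClosedImmersion (emb ι) := ‹_›
  -- standing consequences of projectivity
  haveI : IsProper (projectiveSpace n k).hom := isProper_projectiveSpace n k
  haveI : IsProper Z.hom := by rw [← Over.w ι]; infer_instance
  haveI : IsProper g := IsProjectiveOver.isProper (X := Over.mk g) hY
  haveI : IsProper (f ≫ g) := by rw [hf]; infer_instance
  haveI : IsProper f := IsProper.of_comp f g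
  haveI : LocallyOfFiniteType Z.hom := inferInstance
  haveI : JacobsonSpace Z.left := LocallyOfFiniteType.jacobsonSpace Z.hom
  haveI : JacobsonSpace Y := LocallyOfFiniteType.jacobsonSpace g
  haveI : IsLocallyNoetherian Z.left := LocallyOfFiniteType.isLocallyNoetherian Z.hom
  haveI : CompactSpace Z.left := by
    haveI : QuasiCompact Z.hom := inferInstance
    exact QuasiCompact.compactSpace_of_compactSpace Z.hom
  haveI : IsNoetherian Z.left := {}
  haveI : QuasiSeparatedSpace Z.left := quasiSeparatedSpace_of_quasiSeparated Z.hom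
  have hUaff := isAffineOpen_ofHom_U (emb ι)
  -- (α) finitely many basic open charts covering `X`, and the degree `m`
  obtain ⟨t, ht⟩ := exists_finset_basicOpen_cover ι f
  have hWaff : ∀ a : (Σ (U : Y.affineOpens) (i : Fin (n + 1)),
      {h : Γ(Z.left, preU (emb ι) i) // Z.left.basicOpen h ≤ f ⁻¹ᵁ (U : Y.Opens)}),
      IsAffineOpen (Z.left.basicOpen a.2.2.1) := fun a => (hUaff a.2.1).basicOpen _
  have he' : ∀ a : (Σ (U : Y.affineOpens) (i : Fin (n + 1)),
      {h : Γ(Z.left, preU (emb ι) i) // Z.left.basicOpen h ≤ f ⁻¹ᵁ (U : Y.Opens)}),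
      ∃ e : ℕ, ringKrullDim Γ(Z.left, Z.left.basicOpen a.2.2.1) ≤ e := fun a =>
    haveI := finiteType_sec'' (Z := Z) (hWaff a)
    exists_nat_ringKrullDim_le k _
  choose eα heα using he'
  set e : ℕ := t.sup eα with he
  set m : ℕ := max e 1 with hm
  have hm1 : 1 ≤ m := le_max_right _ _
  have hem : e ≤ m := le_max_left _ _
  -- the finite bad set `B = f⁻¹(y) ∖ sm(f)` and an affine open `U₀ ∋ y`
  set B : Set Z.left := f ⁻¹' {y} ∩ (f.smoothLocus : Set Z.left)ᶜ with hB
  have hBfin : B.Finite :=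
    finite_preimage_singleton_inter_compl_smoothLocus f (fun C hC => (hdim y C hC).le) (hdense y)
  have hBcl : IsClosed B := (hy.preimage f.continuous).inter f.smoothLocus.2.isClosed_compl
  obtain ⟨U₀, hU₀, hyU₀, -⟩ :=
    exists_isAffineOpen_mem_and_subset (X := Y) (x := y) (U := ⊤) (Opens.mem_top _)
  -- (β) finitely many basic open charts inside `f⁻¹(U₀) ∖ B` covering `f⁻¹(y) ∩ sm(f)`
  let O : Z.left.Opens := f ⁻¹ᵁ U₀ ⊓ ⟨Bᶜ, hBcl.isOpen_compl⟩
  obtain ⟨t', ht'⟩ := exists_finset_basicOpen_cover_of_subset ι O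
    (S := f ⁻¹' {y} ∩ (f.smoothLocus : Set Z.left)) (by
      rintro x ⟨hxy, hxs⟩
      exact ⟨show f x ∈ U₀ by rw [show f x = y from hxy]; exact hyU₀, fun hxB => hxB.2 hxs⟩)
  have hWU₀ : ∀ b : (Σ (i : Fin (n + 1)), {h : Γ(Z.left, preU (emb ι) i) // Z.left.basicOpen h ≤ O}),
      Z.left.basicOpen b.2.1 ≤ f ⁻¹ᵁ U₀ := fun b => b.2.2.trans inf_le_left
  have hWaff' : ∀ b : (Σ (i : Fin (n + 1)), {h : Γ(Z.left, preU (emb ι) i) // Z.left.basicOpen h ≤ O}),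
      IsAffineOpen (Z.left.basicOpen b.2.1) := fun b => (hUaff b.1).basicOpen _
  have hsm' : ∀ b : (Σ (i : Fin (n + 1)), {h : Γ(Z.left, preU (emb ι) i) // Z.left.basicOpen h ≤ O}),
      ∀ p : PrimeSpectrum Γ(Z.left, Z.left.basicOpen b.2.1), p.asIdeal.IsMaximal →
        fibreIdeal f hU₀ (hWU₀ b) hyU₀ ≤ p.asIdeal →
          (hWaff' b).fromSpec p ∈ f.smoothLocus := by
    intro b p hp hle
    have hymax := isMaximal_primeIdealOf_of_isClosed hU₀ hyU₀ hy
    have hfp : f ((hWaff' b).fromSpec p) = y :=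
      (apply_fromSpec_eq_iff_map_le f hU₀ (hWaff' b) (hWU₀ b) ⟨y, hyU₀⟩ hymax p).mpr hle
    have hpW : (hWaff' b).fromSpec p ∈ Z.left.basicOpen b.2.1 := by
      rw [← SetLike.mem_coe, ← (hWaff' b).range_fromSpec]
      exact ⟨p, rfl⟩
    have hpO : (hWaff' b).fromSpec p ∈ O := b.2.2 hpW
    by_contra hns
    exact hpO.2 ⟨hfp, hns⟩
  -- the generic conditions (c1) (c2) (c3)
  have hc1 : IsGeneric fun a : Monomials (Fin (n + 1)) m → k => ∀ b ∈ B,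
      b ∉ (((ofHom (emb ι)).secOfForm Z.hom (formOfCoeffs a)
        (isHomogeneous_formOfCoeffs a)).zeroIdeal.support : Set Z.left) :=
    IsGeneric.forall_mem_finite hBfin fun b hb =>
      isGeneric_notMem_support ι (isClosed_singleton_of_mem_finite hBcl hBfin hb)
  have hc2 : IsGeneric fun a : Monomials (Fin (n + 1)) m → k => ∀ c ∈ t,
      ∀ 𝔫 : Ideal Γ(Y, (c.1 : Y.Opens)), 𝔫.IsMaximal →
        ∀ P ∈ (𝔫.map (f.appLE c.1 (Z.left.basicOpen c.2.2.1) c.2.2.2).hom).minimalPrimes,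
          Z.left.presheaf.map (homOfLE (Z.left.basicOpen_le c.2.2.1)).op
            ((ofHom (emb ι)).sectionsFun Z.hom c.2.1 (formOfCoeffs a)) ∉ P :=
    IsGeneric.forall_finset t fun c hc =>
      isGeneric_forall_notMem_minimalPrimes ι f g hf hdim c.1.2 c.2.1 c.2.2.1 (hWaff c) c.2.2.2
        hem ((heα c).trans (by exact_mod_cast Finset.le_sup hc))
  have hc3 : IsGeneric fun a : Monomials (Fin (n + 1)) m → k => ∀ b ∈ t',
      ∀ 𝔪 : Ideal (Γ(Z.left, Z.left.basicOpen b.2.1) ⧸ fibreIdeal f hU₀ (hWU₀ b) hyU₀), 𝔪.IsMaximal →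
        Ideal.Quotient.mk _ (Z.left.presheaf.map (homOfLE (Z.left.basicOpen_le b.2.1)).op
            ((ofHom (emb ι)).sectionsFun Z.hom b.1 (formOfCoeffs a))) ∈ 𝔪 →
          LocallyGenerates 𝔪 (Ideal.Quotient.mk _ (Z.left.presheaf.map
            (homOfLE (Z.left.basicOpen_le b.2.1)).op
              ((ofHom (emb ι)).sectionsFun Z.hom b.1 (formOfCoeffs a)))) :=
    IsGeneric.forall_finset t' fun b _ =>
      isGeneric_forall_locallyGenerates_fibreRing ι f hdim hU₀ b.1 b.2.1
        (hWaff' b) (hWU₀ b) hyU₀ hy hm1 (hsm' b)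
  have hc0 := (hc1.and hc2).and hc3
  -- zeros on `f⁻¹(y)` of a form satisfying (c2) are finitely many closed points
  have hfinS : ∀ a : Monomials (Fin (n + 1)) m → k, (∀ c ∈ t,
      ∀ 𝔫 : Ideal Γ(Y, (c.1 : Y.Opens)), 𝔫.IsMaximal →
        ∀ P ∈ (𝔫.map (f.appLE c.1 (Z.left.basicOpen c.2.2.1) c.2.2.2).hom).minimalPrimes,
          Z.left.presheaf.map (homOfLE (Z.left.basicOpen_le c.2.2.1)).op
            ((ofHom (emb ι)).sectionsFun Z.hom c.2.1 (formOfCoeffs a)) ∉ P) →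
      ((((ofHom (emb ι)).secOfForm Z.hom (formOfCoeffs a)
        (isHomogeneous_formOfCoeffs a)).zeroIdeal.support : Set Z.left) ∩ f ⁻¹' {y}).Finite ∧
      IsClosed ((((ofHom (emb ι)).secOfForm Z.hom (formOfCoeffs a)
        (isHomogeneous_formOfCoeffs a)).zeroIdeal.support : Set Z.left) ∩ f ⁻¹' {y}) := by
    intro a ha
    have hcl : IsClosed ((((ofHom (emb ι)).secOfForm Z.hom (formOfCoeffs a)
        (isHomogeneous_formOfCoeffs a)).zeroIdeal.support : Set Z.left) ∩ f ⁻¹' {y}) :=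
      (Scheme.IdealSheafData.support _).isClosed.inter (hy.preimage f.continuous)
    exact ⟨finite_of_isClosed_of_topologicalKrullDim_le_zero hcl
      (topologicalKrullDim_le_zero_of_charts ι f hdim t ht _ _ ha hy), hcl⟩
  -- choose `a₁`, then `a₂` avoiding the zeros of `G₁` on `f⁻¹(y)`, then `a₃`
  obtain ⟨a₁, ⟨ha₁1, ha₁2⟩, ha₁3⟩ := hc0.nonempty
  obtain ⟨hS₁fin, hS₁cl⟩ := hfinS a₁ ha₁2
  obtain ⟨a₂, ⟨⟨ha₂1, ha₂2⟩, ha₂3⟩, ha₂S⟩ := hc0.exists_and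
    (IsGeneric.forall_mem_finite hS₁fin fun b hb =>
      isGeneric_notMem_support ι (m := m) (isClosed_singleton_of_mem_finite hS₁cl hS₁fin hb))
  obtain ⟨hS₂fin, hS₂cl⟩ := hfinS a₂ ha₂2
  obtain ⟨a₃, ⟨⟨ha₃1, ha₃2⟩, ha₃3⟩, ha₃S₁, ha₃S₂⟩ := hc0.exists_and
    ((IsGeneric.forall_mem_finite hS₁fin fun b hb =>
      isGeneric_notMem_support ι (m := m) (isClosed_singleton_of_mem_finite hS₁cl hS₁fin hb)).and
     (IsGeneric.forall_mem_finite hS₂fin fun b hb =>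
      isGeneric_notMem_support ι (m := m) (isClosed_singleton_of_mem_finite hS₂cl hS₂fin hb)))
  -- the forms `G_j = formOfCoeffs a_j` and the hypersurface section `I = V(G₁G₂G₃(s))`
  have h₁ : (formOfCoeffs a₁).IsHomogeneous m := isHomogeneous_formOfCoeffs a₁
  have h₂ : (formOfCoeffs a₂).IsHomogeneous m := isHomogeneous_formOfCoeffs a₂
  have h₃ : (formOfCoeffs a₃).IsHomogeneous m := isHomogeneous_formOfCoeffs a₃
  obtain ⟨I, hI⟩ : ∃ I : Z.left.IdealSheafData, I = ((ofHom (emb ι)).secOfForm Z.hom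
      (formOfCoeffs a₁ * formOfCoeffs a₂ * formOfCoeffs a₃) ((h₁.mul h₂).mul h₃)).zeroIdeal :=
    ⟨_, rfl⟩
  -- supports
  have hsupp : ∀ x : Z.left, x ∈ (I.support : Set Z.left) ↔
      x ∈ (((ofHom (emb ι)).secOfForm Z.hom (formOfCoeffs a₁) h₁).zeroIdeal.support :
        Set Z.left) ∨
      x ∈ (((ofHom (emb ι)).secOfForm Z.hom (formOfCoeffs a₂) h₂).zeroIdeal.support :
        Set Z.left) ∨
      x ∈ (((ofHom (emb ι)).secOfForm Z.hom (formOfCoeffs a₃) h₃).zeroIdeal.support :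
        Set Z.left) := by
    intro x
    rw [hI, mem_support_zeroIdeal_secOfForm_mul_iff ι (formOfCoeffs a₁ * formOfCoeffs a₂)
      (formOfCoeffs a₃) (h₁.mul h₂) h₃,
      mem_support_zeroIdeal_secOfForm_mul_iff ι (formOfCoeffs a₁) (formOfCoeffs a₂) h₁ h₂,
      or_assoc]
  -- (A3)
  have hA3 : (I.support : Set Z.left) ∩ f ⁻¹' {y} ⊆ f.smoothLocus := by
    rintro x ⟨hxI, hxy⟩
    by_contra hxs
    have hxB : x ∈ B := ⟨hxy, hxs⟩
    rcases (hsupp x).mp hxI with h | h | h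
    · exact ha₁1 x hxB h
    · exact ha₂1 x hxB h
    · exact ha₃1 x hxB h
  -- (A2) at closed points, finiteness, (A2) everywhere
  have hA2c : ∀ y' : Y, IsClosed ({y'} : Set Y) →
      topologicalKrullDim ↥((I.support : Set Z.left) ∩ f ⁻¹' {y'}) ≤ 0 := by
    intro y' hy'
    rw [hI]
    refine topologicalKrullDim_le_zero_of_charts ι f hdim t ht _ _ (fun c hc 𝔫 h𝔫 P hP => ?_) hy'
    haveI : P.IsPrime := hP.1.1
    rw [rs_sectionsFun_mul, rs_sectionsFun_mul]
    intro hmem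
    rcases (Ideal.IsPrime.mem_or_mem inferInstance hmem) with h12 | h3
    · rcases (Ideal.IsPrime.mem_or_mem inferInstance h12) with h1 | h2
      · exact ha₁2 c hc 𝔫 h𝔫 P hP h1
      · exact ha₂2 c hc 𝔫 h𝔫 P hP h2
    · exact ha₃2 c hc 𝔫 h𝔫 P hP h3
  haveI hfin : IsFinite (I.subschemeι ≫ f) := isFinite_subschemeι_comp_of_closedPoints f I hA2c
  have hA2 : ∀ y' : Y, topologicalKrullDim ↥((I.support : Set Z.left) ∩ f ⁻¹' {y'}) ≤ 0 :=
    topologicalKrullDim_support_inter_preimage_le_zero_of_isFinite f I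
  -- (A1): some point of `f⁻¹(y)` is off `H`, since `f⁻¹(y)` has a component of dimension `1`
  have hA1 : IsEffectiveCartier I := by
    rw [hI]
    refine ((ofHom (emb ι)).secOfForm Z.hom _ ((h₁.mul h₂).mul h₃)).isEffectiveCartier_zeroIdeal_of_isIntegral
      hUaff fun huniv => ?_
    rw [← hI] at huniv
    obtain ⟨x, hx⟩ := f.surjective y
    obtain ⟨z, -⟩ : x ∈ Set.range (f.fiberι y) := by rw [Scheme.Hom.range_fiberι]; exact hx
    have hCmem : irreducibleComponent z ∈ irreducibleComponents ↥(f.fiber y) :=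
      irreducibleComponent_mem_irreducibleComponents z
    have hmap : ∀ w : ↥(irreducibleComponent z),
        f.fiberι y w.1 ∈ (I.support : Set Z.left) ∩ f ⁻¹' {y} := fun w =>
      ⟨by rw [huniv]; trivial, Literature.AlgebraicGeometry.Motives.apply_fiberι f y w.1⟩
    have hr : Topology.IsInducing (fun w : ↥(irreducibleComponent z) =>
        (⟨f.fiberι y w.1, hmap w⟩ : ↥((I.support : Set Z.left) ∩ f ⁻¹' {y}))) :=
      Topology.IsInducing.codRestrict
        ((f.fiberι y).isEmbedding.isInducing.comp Topology.IsInducing.subtypeVal) hmap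
    have h1 := hr.topologicalKrullDim_le
    rw [hdim y _ hCmem] at h1
    exact absurd (h1.trans (hA2 y)) (by decide)
  -- (A4): at each point of `H ∩ f⁻¹(y)` exactly one `G_j` vanishes, to first order
  have hA4 : IsReduced ((I.subschemeι ≫ f).fiber y) := by
    refine isReduced_fiber_subschemeι_comp_of_locallyGenerates f I fun x hxI hxy => ?_
    have hxs : x ∈ f.smoothLocus := hA3 ⟨hxI, hxy⟩
    obtain ⟨b, hb, hxb⟩ : ∃ b ∈ t', x ∈ (Z.left.basicOpen b.2.1 : Set Z.left) := by
      have := ht' ⟨hxy, hxs⟩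
      simp only [Set.mem_iUnion] at this
      obtain ⟨b, hb, hxb⟩ := this
      exact ⟨b, hb, hxb⟩
    have hWb : IsAffineOpen (Z.left.basicOpen b.2.1) := hWaff' b
    have hbU : Z.left.basicOpen b.2.1 ≤ preU (emb ι) b.1 := Z.left.basicOpen_le b.2.1
    have hxU : x ∈ preU (emb ι) b.1 := hbU hxb
    -- the restricted chart values `v_j` of the three forms and the local equation `v₁ v₂ v₃`
    have hIW : I.ideal ⟨Z.left.basicOpen b.2.1, hWb⟩ = Ideal.span
        {rs hbU ((ofHom (emb ι)).sectionsFun Z.hom b.1 (formOfCoeffs a₁)) *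
          rs hbU ((ofHom (emb ι)).sectionsFun Z.hom b.1 (formOfCoeffs a₂)) *
          rs hbU ((ofHom (emb ι)).sectionsFun Z.hom b.1 (formOfCoeffs a₃))} := by
      rw [hI, Sec.ideal_zeroIdeal _ hUaff ⟨Z.left.basicOpen b.2.1, hWb⟩ hbU, secOfForm_val,
        map_mul, map_mul, map_mul, map_mul]
      rfl
    refine ⟨U₀, hU₀, hyU₀, Z.left.basicOpen b.2.1, hWb, hxb, hWU₀ b, _, hIW, ?_⟩
    -- the prime of `x` (a closed point) contains the fibre ideal
    have hxcl : IsClosed ({x} : Set Z.left) := by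
      have hcl' : IsClosed ((I.support : Set Z.left) ∩ f ⁻¹' {y}) :=
        I.support.isClosed.inter (hy.preimage f.continuous)
      exact isClosed_singleton_of_mem_finite hcl'
        (finite_of_isClosed_of_topologicalKrullDim_le_zero hcl' (hA2 y)) ⟨hxI, hxy⟩
    haveI h𝔭max : (hWb.primeIdealOf ⟨x, hxb⟩).asIdeal.IsMaximal :=
      isMaximal_primeIdealOf_of_isClosed hWb hxb hxcl
    have hymax := isMaximal_primeIdealOf_of_isClosed hU₀ hyU₀ hy
    have hN𝔭 : fibreIdeal f hU₀ (hWU₀ b) hyU₀ ≤ (hWb.primeIdealOf ⟨x, hxb⟩).asIdeal :=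
      (apply_fromSpec_eq_iff_map_le f hU₀ hWb (hWU₀ b) ⟨y, hyU₀⟩ hymax
        (hWb.primeIdealOf ⟨x, hxb⟩)).mp (by rw [IsAffineOpen.fromSpec_primeIdealOf]; exact hxy)
    haveI h𝔪max : ((hWb.primeIdealOf ⟨x, hxb⟩).asIdeal.map
        (Ideal.Quotient.mk (fibreIdeal f hU₀ (hWU₀ b) hyU₀))).IsMaximal :=
      Ideal.IsMaximal.map_of_surjective_of_ker_le Ideal.Quotient.mk_surjective
        (by rw [Ideal.mk_ker]; exact hN𝔭)
    have hmem𝔪 : ∀ w : Γ(Z.left, Z.left.basicOpen b.2.1),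
        Ideal.Quotient.mk (fibreIdeal f hU₀ (hWU₀ b) hyU₀) w ∈
            (hWb.primeIdealOf ⟨x, hxb⟩).asIdeal.map
              (Ideal.Quotient.mk (fibreIdeal f hU₀ (hWU₀ b) hyU₀)) ↔
          w ∈ (hWb.primeIdealOf ⟨x, hxb⟩).asIdeal := by
      intro w
      rw [Ideal.mem_quotient_iff_mem_sup, sup_eq_left.mpr hN𝔭]
    -- `v_j ∈ 𝔭_x` iff `x ∈ V(G_j)`
    have hvmem : ∀ (G : MvPolynomial (Fin (n + 1)) k) (hG : G.IsHomogeneous m),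
        rs hbU ((ofHom (emb ι)).sectionsFun Z.hom b.1 G) ∈ (hWb.primeIdealOf ⟨x, hxb⟩).asIdeal ↔
          x ∈ (((ofHom (emb ι)).secOfForm Z.hom G hG).zeroIdeal.support : Set Z.left) := by
      intro G hG
      rw [SetLike.mem_coe, ((ofHom (emb ι)).secOfForm Z.hom G hG).mem_support_zeroIdeal_iff
        hUaff hxU, secOfForm_val]
      have e1 := FieldNorm.mem_basicOpen_iff_notMem_primeIdealOf hWb
        (rs hbU ((ofHom (emb ι)).sectionsFun Z.hom b.1 G)) hxb
      have e2 : Z.left.basicOpen (rs hbU ((ofHom (emb ι)).sectionsFun Z.hom b.1 G)) =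
          Z.left.basicOpen b.2.1 ⊓ Z.left.basicOpen ((ofHom (emb ι)).sectionsFun Z.hom b.1 G) :=
        Scheme.basicOpen_res _ _ _
      constructor
      · intro hv hx'
        exact (e1.mp (by rw [e2]; exact ⟨hxb, hx'⟩)) hv
      · intro hx'
        by_contra hv
        exact hx' (by have := e1.mpr hv; rw [e2] at this; exact this.2)
    -- (c3) for `a_j` on the chart `b`: a vanishing `v_j` is a local parameter of the fibre ring
    have hgen : ∀ a : Monomials (Fin (n + 1)) m → k, (∀ b' ∈ t',
        ∀ 𝔪' : Ideal (Γ(Z.left, Z.left.basicOpen b'.2.1) ⧸ fibreIdeal f hU₀ (hWU₀ b') hyU₀),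
          𝔪'.IsMaximal →
          Ideal.Quotient.mk _ (Z.left.presheaf.map (homOfLE (Z.left.basicOpen_le b'.2.1)).op
              ((ofHom (emb ι)).sectionsFun Z.hom b'.1 (formOfCoeffs a))) ∈ 𝔪' →
            LocallyGenerates 𝔪' (Ideal.Quotient.mk _ (Z.left.presheaf.map
              (homOfLE (Z.left.basicOpen_le b'.2.1)).op
                ((ofHom (emb ι)).sectionsFun Z.hom b'.1 (formOfCoeffs a))))) →
        rs hbU ((ofHom (emb ι)).sectionsFun Z.hom b.1 (formOfCoeffs a)) ∈
              (hWb.primeIdealOf ⟨x, hxb⟩).asIdeal →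
          LocallyGenerates ((hWb.primeIdealOf ⟨x, hxb⟩).asIdeal.map
              (Ideal.Quotient.mk (fibreIdeal f hU₀ (hWU₀ b) hyU₀)))
            (Ideal.Quotient.mk (fibreIdeal f hU₀ (hWU₀ b) hyU₀)
              (rs hbU ((ofHom (emb ι)).sectionsFun Z.hom b.1 (formOfCoeffs a)))) :=
      fun a ha hva => ha b hb _ h𝔪max ((hmem𝔪 _).mpr hva)
    rw [map_mul, map_mul]
    rcases (hsupp x).mp hxI with hx1 | hx2 | hx3
    · -- `G₁(x) = 0`: `x ∈ S₁`, so `G₂(x), G₃(x) ≠ 0`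
      have hxS₁ : x ∈ (((ofHom (emb ι)).secOfForm Z.hom (formOfCoeffs a₁)
          (isHomogeneous_formOfCoeffs a₁)).zeroIdeal.support : Set Z.left) ∩ f ⁻¹' {y} :=
        ⟨hx1, hxy⟩
      have hn2 := fun h => ha₂S x hxS₁ ((hvmem (formOfCoeffs a₂) h₂).mp h)
      have hn3 := fun h => ha₃S₁ x hxS₁ ((hvmem (formOfCoeffs a₃) h₃).mp h)
      exact ((hgen a₁ ha₁3 ((hvmem _ h₁).mpr hx1)).mul_of_not_mem
        (mt (hmem𝔪 _).mp hn2)).mul_of_not_mem (mt (hmem𝔪 _).mp hn3)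
    · by_cases hx1 : x ∈ (((ofHom (emb ι)).secOfForm Z.hom (formOfCoeffs a₁) h₁).zeroIdeal.support :
          Set Z.left)
      · exact absurd hx2 (ha₂S x ⟨hx1, hxy⟩)
      · -- `G₂(x) = 0`, `G₁(x) ≠ 0`: `x ∈ S₂`, so `G₃(x) ≠ 0`
        have hxS₂ : x ∈ (((ofHom (emb ι)).secOfForm Z.hom (formOfCoeffs a₂)
            (isHomogeneous_formOfCoeffs a₂)).zeroIdeal.support : Set Z.left) ∩ f ⁻¹' {y} :=
          ⟨hx2, hxy⟩
        have hn1 := fun h => hx1 ((hvmem (formOfCoeffs a₁) h₁).mp h)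
        have hn3 := fun h => ha₃S₂ x hxS₂ ((hvmem (formOfCoeffs a₃) h₃).mp h)
        exact ((hgen a₂ ha₂3 ((hvmem _ h₂).mpr hx2)).mul_of_not_mem_left
          (mt (hmem𝔪 _).mp hn1)).mul_of_not_mem (mt (hmem𝔪 _).mp hn3)
    · by_cases hx1 : x ∈ (((ofHom (emb ι)).secOfForm Z.hom (formOfCoeffs a₁) h₁).zeroIdeal.support :
          Set Z.left)
      · exact absurd hx3 (ha₃S₁ x ⟨hx1, hxy⟩)
      · by_cases hx2 : x ∈ (((ofHom (emb ι)).secOfForm Z.hom (formOfCoeffs a₂)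
            h₂).zeroIdeal.support : Set Z.left)
        · exact absurd hx3 (ha₃S₂ x ⟨hx2, hxy⟩)
        · -- `G₃(x) = 0` only
          have hn1 := fun h => hx1 ((hvmem (formOfCoeffs a₁) h₁).mp h)
          have hn2 := fun h => hx2 ((hvmem (formOfCoeffs a₂) h₂).mp h)
          have hn12 : Ideal.Quotient.mk (fibreIdeal f hU₀ (hWU₀ b) hyU₀)
                (rs hbU ((ofHom (emb ι)).sectionsFun Z.hom b.1 (formOfCoeffs a₁))) *
              Ideal.Quotient.mk (fibreIdeal f hU₀ (hWU₀ b) hyU₀)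
                (rs hbU ((ofHom (emb ι)).sectionsFun Z.hom b.1 (formOfCoeffs a₂))) ∉
              (hWb.primeIdealOf ⟨x, hxb⟩).asIdeal.map
                (Ideal.Quotient.mk (fibreIdeal f hU₀ (hWU₀ b) hyU₀)) := fun h =>
            (Ideal.IsPrime.mem_or_mem inferInstance h).elim (mt (hmem𝔪 _).mp hn1)
              (mt (hmem𝔪 _).mp hn2)
          exact (hgen a₃ ha₃3 ((hvmem _ h₃).mpr hx3)).mul_of_not_mem_left hn12
  exact ⟨m, hm1, _, _, _, h₁, h₂, h₃, I, hI, hA1, hA2, hA3, hA4, hfin⟩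

end Literature.AlgebraicGeometry.Resolution

end
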